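import Summits.Langlands.Langlands.Theorems.PhantomRMYoshidaResiduallyYoshidaLiftingRibetCore
import Summits.Langlands.Langlands.Theorems.PhantomRMYoshidaResiduallyYoshidaLiftingRibetTransport
import Summits.Langlands.Langlands.Theorems.PhantomRMYoshidaResiduallyYoshidaLiftingResidualBlockDiagonalFrame
import Summits.Langlands.Langlands.Theorems.PhantomRMYoshidaResiduallyYoshidaLiftingBlockOrientation
import Literature.RepresentationTheory.Semisimple.BurnsideMatrixSpan
import HarnessLib

/-!
# Ribet's non-split lattice over `ℤ̄_p` — V. The crux-level theorem `stub_ribetNonsplitLattice`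

Lead prover-line-stmt-Langlands-13639-c2-0 (line `sector-klingen-split`, crux `ResiduallyYoshidaLifting`,
stmt-Langlands-13639).  REGISTERED STUB `stub_ribetNonsplitLattice` (census §7 R1(a), the strategist's First lemma
of the non-split-lattice idea for the generic-sector child `KlingenDensityGeneric`, corrected by a residual
conjugator `h ∈ GL₄(k)` — necessary because `red : ℤ̄_p → k` need not be surjective).

Statement.  `r : Γ_ℚ → GL₄(ℚ̄_p)` continuous and IRREDUCIBLE, with a.e. Frobenius polynomials reducing through
`red` to `charpoly σ · charpoly σ'` for irreducible non-conjugate `σ, σ' : Γ_ℚ → GL₂(k)`: then some `ℤ̄_p`-integral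
frame `rint = P⁻¹ r P` has reduction `h · (σ, B; 0, σ') · h⁻¹` with `B` NOT a coboundary `σ X - X σ'` — a lattice
realising a NON-SPLIT extension of `σ̄'` by `σ̄`, i.e. a non-zero class `c(r) ∈ H¹(ℚ, Hom(σ̄', σ̄))`.

Assembly.  `stub_residualBlockDiagonalFrame` (p137982: integral frame with block-DIAGONAL reduction `a ⊕ d`
over the residue field `κ` of `ℤ̄_p`, irreducible blocks through `f : κ ↪ k`, charpoly product identity);
`stub_blockOrientation` (p138134: `f∘a ∼ σ, f∘d ∼ σ'` or the swap) packaged as an equivalence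
`ε : Fin 2 ⊕ Fin 2 ≃ Fin 4` (`exists_oriented_equiv`); Burnside for `r` (tree `span_eq_top_of_isIrreducible`)
transported to the reindexed integral frame; RIBET OVER `ℤ̄_p` (`exists_nonsplit_frame`, file IV — the direct
proof over the non-discrete valuation ring, files I–IV); reindex back to `Fin 4` (the frame absorbs
`reindex ε ε Q`, the residual conjugator is a permutation matrix times `diag(h₁, h₂)⁻¹`); and the corner stays a
non-coboundary over `k` by `coboundary_descent` (file II) for the subfield `f(κ) ⊆ k`.

References: K. Ribet, Invent. Math. 34 (1976), Prop. 2.1; J. Bellaïche, G. Chenevier, Astérisque 324 (2009),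
Thm. 1.5.5.
-/

noncomputable section

open scoped MatrixGroups

open Matrix IsLocalRing

-- `Summit.Langlands.Langlands.…` (summit = sub-problem name, D-0017 layout) trips `dupNamespace` on every decl.
set_option linter.dupNamespace false
set_option autoImplicit false

namespace Summit.Langlands.Langlands.Cruxes.ResiduallyYoshidaLifting.SectorKlingenSplit.Ribet

open Summit.Langlands.Langlands.Cruxes.ResiduallyYoshidaLifting.EndoscopicCrossingEuler

section Assembly

variable {p : ℕ} [Fact p.Prime]

open IsDedekindDomain Filter
open Literature.NumberTheory.GaloisRepresentations Literature.NumberTheory.Automorphic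

/-- Burnside for an irreducible framed Galois representation over `ℚ̄_p`: its matrices span `M₄(ℚ̄_p)`, and so
do those of any conjugate. [folklore] -/
theorem span_range_conj_framedGaloisRep_eq_top (r : FramedGaloisRep ℚ (PadicAlgCl p) 4)
    (hr : r.toGaloisRep.IsIrreducible) (P : GL (Fin 4) (PadicAlgCl p)) :
    Submodule.span (PadicAlgCl p) (Set.range fun g =>
      ((P⁻¹ * r g * P : GL (Fin 4) (PadicAlgCl p)) : Matrix (Fin 4) (Fin 4) (PadicAlgCl p))) = ⊤ := by
  haveI : Representation.IsIrreducible ((glStdRepresentation (Fin 4) (PadicAlgCl p)).comp r.toMonoidHom) := hr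
  have h := Literature.RepresentationTheory.Semisimple.span_eq_top_of_isIrreducible r.toMonoidHom
  have h2 := span_range_conj_eq_top _ P h
  simp only [Units.val_mul] at h2 ⊢
  exact h2

/-- Orientation packaging: from the block-diagonal residual frame `(a ⊕ d)` and the Brauer–Nesbitt dichotomy,
an equivalence `ε : Fin 2 ⊕ Fin 2 ≃ Fin 4` (the standard one or its summand swap) after which the residual
diagonal blocks `(a₁, d₁)` satisfy `f∘a₁ ∼ σ`, `f∘d₁ ∼ σ'`. [folklore] -/
theorem exists_oriented_equiv {Γ : Type*} [Group Γ] {k : Type*} [Field k]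
    (f : ResidueField (Valued.integer (PadicAlgCl p)) →+* k)
    (rint : Γ →* GL (Fin 4) (Valued.integer (PadicAlgCl p)))
    (a d : Γ →* GL (Fin 2) (ResidueField (Valued.integer (PadicAlgCl p)))) (σ σ' : Γ →* GL (Fin 2) k)
    (hred : ∀ g, (Matrix.GeneralLinearGroup.map (residue (Valued.integer (PadicAlgCl p))) (rint g)).val =
      Matrix.reindex finSumFinEquiv finSumFinEquiv (Matrix.fromBlocks (a g).val 0 0 (d g).val))
    (hor : (∃ h₁ h₂ : GL (Fin 2) k, ∀ g, h₁ * Matrix.GeneralLinearGroup.map f (a g) * h₁⁻¹ = σ g ∧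
        h₂ * Matrix.GeneralLinearGroup.map f (d g) * h₂⁻¹ = σ' g) ∨
      (∃ h₁ h₂ : GL (Fin 2) k, ∀ g, h₁ * Matrix.GeneralLinearGroup.map f (a g) * h₁⁻¹ = σ' g ∧
        h₂ * Matrix.GeneralLinearGroup.map f (d g) * h₂⁻¹ = σ g)) :
    ∃ (ε : Fin 2 ⊕ Fin 2 ≃ Fin 4) (a₁ d₁ : Γ →* GL (Fin 2) (ResidueField (Valued.integer (PadicAlgCl p))))
      (h₁ h₂ : GL (Fin 2) k),
      (∀ g, (((rint g : GL (Fin 4) (Valued.integer (PadicAlgCl p))) :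
          Matrix (Fin 4) (Fin 4) (Valued.integer (PadicAlgCl p))).map
            (residue (Valued.integer (PadicAlgCl p)))).submatrix ε ε =
        Matrix.fromBlocks (a₁ g).val 0 0 (d₁ g).val) ∧
      (∀ g, h₁ * Matrix.GeneralLinearGroup.map f (a₁ g) * h₁⁻¹ = σ g ∧
        h₂ * Matrix.GeneralLinearGroup.map f (d₁ g) * h₂⁻¹ = σ' g) := by
  have hred' : ∀ g, (((rint g : GL (Fin 4) (Valued.integer (PadicAlgCl p))) :
      Matrix (Fin 4) (Fin 4) (Valued.integer (PadicAlgCl p))).map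
        (residue (Valued.integer (PadicAlgCl p)))).submatrix finSumFinEquiv finSumFinEquiv =
      Matrix.fromBlocks (a g).val 0 0 (d g).val := by
    intro g
    have h1 : ((rint g : GL (Fin 4) (Valued.integer (PadicAlgCl p))) :
        Matrix (Fin 4) (Fin 4) (Valued.integer (PadicAlgCl p))).map (residue (Valued.integer (PadicAlgCl p))) =
        (Matrix.GeneralLinearGroup.map (residue (Valued.integer (PadicAlgCl p))) (rint g)).val := rfl
    rw [h1, hred g, Matrix.reindex_apply, Matrix.submatrix_submatrix, Equiv.symm_comp_self,
      Matrix.submatrix_id_id]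
  rcases hor with ⟨h₁, h₂, hh⟩ | ⟨h₁, h₂, hh⟩
  · exact ⟨finSumFinEquiv, a, d, h₁, h₂, hred', hh⟩
  · refine ⟨(Equiv.sumComm (Fin 2) (Fin 2)).trans finSumFinEquiv, d, a, h₂, h₁, fun g => ?_,
      fun g => ⟨(hh g).2, (hh g).1⟩⟩
    have : ((((rint g : GL (Fin 4) (Valued.integer (PadicAlgCl p))) :
        Matrix (Fin 4) (Fin 4) (Valued.integer (PadicAlgCl p))).map
          (residue (Valued.integer (PadicAlgCl p)))).submatrix
        ((Equiv.sumComm (Fin 2) (Fin 2)).trans finSumFinEquiv) ((Equiv.sumComm (Fin 2) (Fin 2)).trans finSumFinEquiv)) =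
        ((((rint g : GL (Fin 4) (Valued.integer (PadicAlgCl p))) :
          Matrix (Fin 4) (Fin 4) (Valued.integer (PadicAlgCl p))).map
            (residue (Valued.integer (PadicAlgCl p)))).submatrix finSumFinEquiv finSumFinEquiv).submatrix
          Sum.swap Sum.swap := by
      rw [Matrix.submatrix_submatrix]
      rfl
    rw [this, hred' g, Matrix.fromBlocks_submatrix_sum_swap_sum_swap]

/-- **Ribet's non-split lattice over `ℤ̄_p`** (registered stub `stub_ribetNonsplitLattice`, census §7 R1(a) of
crux `ResiduallyYoshidaLifting`; the strategist's First lemma with the necessary residual conjugator `h`).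
Let `r : Γ_ℚ → GL₄(ℚ̄_p)` be continuous and IRREDUCIBLE, with a.e. Frobenius polynomials reducing through
`red : ℤ̄_p → k` to `charpoly σ · charpoly σ'` for irreducible, non-conjugate `σ, σ' : Γ_ℚ → GL₂(k)`.  Then
some `ℤ̄_p`-integral frame of `r` has reduction conjugate over `k` to `(σ, B; 0, σ')` with `B` NOT a coboundary
`σ X - X σ'`: the lattice realises a NON-SPLIT extension of `σ'` by `σ`.  Proof: files I–IV of this series
(direct Ribet over the non-discrete valuation ring `ℤ̄_p`: rescaling/unipotent iteration run inside a finite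
extension of `ℚ_p` where the value group is discrete, Burnside for the contradiction), the `κ`-frame of
`stub_residualBlockDiagonalFrame`, the orientation of `stub_blockOrientation`, and `coboundary_descent` for
`f(κ) ⊆ k`. [cite: Ribet1976, Prop. 2.1; BellaicheChenevier2009, Thm. 1.5.5] -/
theorem stub_ribetNonsplitLattice :
    ∀ (p : ℕ) [Fact p.Prime] (k : Type) [Field k] [CharP k p] [IsAlgClosed k]
      [TopologicalSpace k] [DiscreteTopology k] (red : Valued.integer (PadicAlgCl p) →+* k)
      (σ σ' : FramedGaloisRep ℚ k 2) (r : FramedGaloisRep ℚ (PadicAlgCl p) 4),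
      σ.toGaloisRep.IsIrreducible → σ'.toGaloisRep.IsIrreducible →
      (¬ ∃ g : GL (Fin 2) k, ∀ x, g * σ x * g⁻¹ = σ' x) →
      r.toGaloisRep.IsIrreducible →
      (∀ᶠ v : HeightOneSpectrum (NumberField.RingOfIntegers ℚ) in Filter.cofinite,
        r.IsUnramifiedAt v ∧ σ.IsUnramifiedAt v ∧ σ'.IsUnramifiedAt v ∧
        ∃ (P : Polynomial (Valued.integer (PadicAlgCl p))) (P₁ P₂ : Polynomial k),
          r.HasFrobCharpolyAt v (P.map (Valued.integer (PadicAlgCl p)).subtype) ∧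
          σ.HasFrobCharpolyAt v P₁ ∧ σ'.HasFrobCharpolyAt v P₂ ∧ P.map red = P₁ * P₂) →
      ∃ (P : GL (Fin 4) (PadicAlgCl p))
        (rint : Field.absoluteGaloisGroup ℚ →* GL (Fin 4) (Valued.integer (PadicAlgCl p)))
        (h : GL (Fin 4) k) (B : Field.absoluteGaloisGroup ℚ → Matrix (Fin 2) (Fin 2) k),
        (∀ g, Matrix.GeneralLinearGroup.map (Valued.integer (PadicAlgCl p)).subtype (rint g) = P⁻¹ * r g * P) ∧
        (∀ g, (Matrix.GeneralLinearGroup.map red (rint g)).val =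
          h.val * Matrix.reindex finSumFinEquiv finSumFinEquiv
            (Matrix.fromBlocks (σ g).val (B g) 0 (σ' g).val) * (h⁻¹).val) ∧
        ¬ ∃ X : Matrix (Fin 2) (Fin 2) k, ∀ g, B g = (σ g).val * X - X * (σ' g).val := by
  intro p _ k _ _ _ _ _ red σ σ' r hσ hσ' hnc hrirr hae
  classical
  -- (F) the `κ`-frame with block-diagonal reduction
  obtain ⟨P, rint, f, a, d, hf, hP, hred, hairr, hdirr, hprod⟩ :=
    stub_residualBlockDiagonalFrame p k red σ σ' r hσ hσ' hae
  have hfres : f.comp (residue (Valued.integer (PadicAlgCl p))) = red := RingHom.ext hf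
  have hcoe : ∀ g i j, ((((rint g : GL (Fin 4) (Valued.integer (PadicAlgCl p))) :
      Matrix (Fin 4) (Fin 4) (Valued.integer (PadicAlgCl p))) i j : Valued.integer (PadicAlgCl p)) :
        PadicAlgCl p) =
      ((P⁻¹ * r g * P : GL (Fin 4) (PadicAlgCl p)) : Matrix (Fin 4) (Fin 4) (PadicAlgCl p)) i j := by
    intro g i j
    rw [← hP g]
    rfl
  -- Burnside, transported to the integral frame
  have hspan4 : Submodule.span (PadicAlgCl p) (Set.range fun g =>
      ((rint g : GL (Fin 4) (Valued.integer (PadicAlgCl p))) :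
        Matrix (Fin 4) (Fin 4) (Valued.integer (PadicAlgCl p))).map (Valued.integer (PadicAlgCl p)).subtype) = ⊤ := by
    have h := span_range_conj_framedGaloisRep_eq_top r hrirr P
    have hfun : (fun g => ((rint g : GL (Fin 4) (Valued.integer (PadicAlgCl p))) :
        Matrix (Fin 4) (Fin 4) (Valued.integer (PadicAlgCl p))).map (Valued.integer (PadicAlgCl p)).subtype) =
        fun g => ((P⁻¹ * r g * P : GL (Fin 4) (PadicAlgCl p)) : Matrix (Fin 4) (Fin 4) (PadicAlgCl p)) :=
      funext fun g => Matrix.ext fun i j => hcoe g i j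
    rw [hfun]
    exact h
  -- (N) orientation
  obtain ⟨ε, a₁, d₁, h₁, h₂, hred₁, hconj⟩ := exists_oriented_equiv f rint a d σ.toMonoidHom σ'.toMonoidHom hred
    (stub_blockOrientation _ k f _ a d σ.toMonoidHom σ'.toMonoidHom hairr hdirr hσ hσ' hnc hprod)
  have hfa : ∀ g, ((a₁ g).val).map f = ((h₁⁻¹ : GL (Fin 2) k) : Matrix (Fin 2) (Fin 2) k) * (σ g).val *
      (h₁ : Matrix (Fin 2) (Fin 2) k) := fun g => val_eq_of_conj_eq (hconj g).1
  have hfd : ∀ g, ((d₁ g).val).map f = ((h₂⁻¹ : GL (Fin 2) k) : Matrix (Fin 2) (Fin 2) k) * (σ' g).val *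
      (h₂ : Matrix (Fin 2) (Fin 2) k) := fun g => val_eq_of_conj_eq (hconj g).2
  -- the reindexed homomorphism `ρε : Γ → GL(Fin 2 ⊕ Fin 2, 𝒪)`
  let ρε : Field.absoluteGaloisGroup ℚ →* GL (Fin 2 ⊕ Fin 2) (Valued.integer (PadicAlgCl p)) :=
    (Units.map (Matrix.reindexRingEquiv (Valued.integer (PadicAlgCl p)) ε.symm).toMonoidHom).comp rint
  have hρε : ∀ g, ((ρε g : GL (Fin 2 ⊕ Fin 2) (Valued.integer (PadicAlgCl p))) :
      Matrix (Fin 2 ⊕ Fin 2) (Fin 2 ⊕ Fin 2) (Valued.integer (PadicAlgCl p))) =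
      ((rint g : GL (Fin 4) (Valued.integer (PadicAlgCl p))) :
        Matrix (Fin 4) (Fin 4) (Valued.integer (PadicAlgCl p))).submatrix ε ε := by
    intro g
    change Matrix.reindex ε.symm ε.symm ((rint g : GL (Fin 4) (Valued.integer (PadicAlgCl p))) :
      Matrix (Fin 4) (Fin 4) (Valued.integer (PadicAlgCl p))) = _
    rw [Matrix.reindex_apply, Equiv.symm_symm]
  have hρεres : ∀ g, ((ρε g : GL (Fin 2 ⊕ Fin 2) (Valued.integer (PadicAlgCl p))) :
      Matrix (Fin 2 ⊕ Fin 2) (Fin 2 ⊕ Fin 2) (Valued.integer (PadicAlgCl p))).map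
        (residue (Valued.integer (PadicAlgCl p))) = Matrix.fromBlocks (a₁ g).val 0 0 (d₁ g).val := by
    intro g
    rw [hρε]
    exact hred₁ g
  have h11 : ∀ g, ((ρε g : GL (Fin 2 ⊕ Fin 2) (Valued.integer (PadicAlgCl p))) :
      Matrix (Fin 2 ⊕ Fin 2) (Fin 2 ⊕ Fin 2) (Valued.integer (PadicAlgCl p))).toBlocks₁₁.map
        (residue (Valued.integer (PadicAlgCl p))) = (a₁ g).val := fun g => by
    rw [← toBlocks₁₁_map, hρεres, Matrix.toBlocks_fromBlocks₁₁]
  have h22 : ∀ g, ((ρε g : GL (Fin 2 ⊕ Fin 2) (Valued.integer (PadicAlgCl p))) :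
      Matrix (Fin 2 ⊕ Fin 2) (Fin 2 ⊕ Fin 2) (Valued.integer (PadicAlgCl p))).toBlocks₂₂.map
        (residue (Valued.integer (PadicAlgCl p))) = (d₁ g).val := fun g => by
    rw [← toBlocks₂₂_map, hρεres, Matrix.toBlocks_fromBlocks₂₂]
  have hCε : ∀ g, ((ρε g : GL (Fin 2 ⊕ Fin 2) (Valued.integer (PadicAlgCl p))) :
      Matrix (Fin 2 ⊕ Fin 2) (Fin 2 ⊕ Fin 2) (Valued.integer (PadicAlgCl p))).toBlocks₂₁.map
        (residue (Valued.integer (PadicAlgCl p))) = 0 := fun g => by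
    rw [← toBlocks₂₁_map, hρεres, Matrix.toBlocks_fromBlocks₂₁]
  -- continuity of the entries
  have hcont : ∀ i j, Continuous fun g => ((((ρε g : GL (Fin 2 ⊕ Fin 2) (Valued.integer (PadicAlgCl p))) :
      Matrix (Fin 2 ⊕ Fin 2) (Fin 2 ⊕ Fin 2) (Valued.integer (PadicAlgCl p))) i j :
        Valued.integer (PadicAlgCl p)) : PadicAlgCl p) := by
    intro i j
    simp_rw [hρε, Matrix.submatrix_apply, hcoe]
    exact (Units.continuous_val.comp ((continuous_const.mul r.continuous_toFun).mul
      continuous_const)).matrix_elem (ε i) (ε j)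
  -- the Burnside span for `ρε`
  have hspanε : Submodule.span (PadicAlgCl p) (Set.range fun g =>
      ((ρε g : GL (Fin 2 ⊕ Fin 2) (Valued.integer (PadicAlgCl p))) :
        Matrix (Fin 2 ⊕ Fin 2) (Fin 2 ⊕ Fin 2) (Valued.integer (PadicAlgCl p))).map
          (Valued.integer (PadicAlgCl p)).subtype) = ⊤ := by
    have hfun : (fun g => ((ρε g : GL (Fin 2 ⊕ Fin 2) (Valued.integer (PadicAlgCl p))) :
        Matrix (Fin 2 ⊕ Fin 2) (Fin 2 ⊕ Fin 2) (Valued.integer (PadicAlgCl p))).map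
          (Valued.integer (PadicAlgCl p)).subtype) =
        fun g => Matrix.reindexLinearEquiv (PadicAlgCl p) (PadicAlgCl p) ε.symm ε.symm
          (((rint g : GL (Fin 4) (Valued.integer (PadicAlgCl p))) :
            Matrix (Fin 4) (Fin 4) (Valued.integer (PadicAlgCl p))).map (Valued.integer (PadicAlgCl p)).subtype) := by
      funext g
      rw [Matrix.coe_reindexLinearEquiv, hρε, Matrix.reindex_apply, Equiv.symm_symm]
      rfl
    rw [hfun]
    exact span_range_comp_eq_top _ _ hspan4
  -- RIBET (files I–IV)
  obtain ⟨Q, ρ', b, hρ', hres', hncb⟩ := exists_nonsplit_frame ρε hcont hCε hspanε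
  -- back to `Fin 4`
  let rint' : Field.absoluteGaloisGroup ℚ →* GL (Fin 4) (Valued.integer (PadicAlgCl p)) :=
    (Units.map (Matrix.reindexRingEquiv (Valued.integer (PadicAlgCl p)) ε).toMonoidHom).comp ρ'
  have hrint' : ∀ g, ((rint' g : GL (Fin 4) (Valued.integer (PadicAlgCl p))) :
      Matrix (Fin 4) (Fin 4) (Valued.integer (PadicAlgCl p))) =
      Matrix.reindex ε ε ((ρ' g : GL (Fin 2 ⊕ Fin 2) (Valued.integer (PadicAlgCl p))) :
        Matrix (Fin 2 ⊕ Fin 2) (Fin 2 ⊕ Fin 2) (Valued.integer (PadicAlgCl p))) := fun g => rfl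
  let Q₄ : GL (Fin 4) (PadicAlgCl p) := Units.map (Matrix.reindexRingEquiv (PadicAlgCl p) ε).toMonoidHom Q
  have hQ₄ : (Q₄ : Matrix (Fin 4) (Fin 4) (PadicAlgCl p)) =
      Matrix.reindex ε ε (Q : Matrix (Fin 2 ⊕ Fin 2) (Fin 2 ⊕ Fin 2) (PadicAlgCl p)) := rfl
  have hQ₄inv : ((Q₄⁻¹ : GL (Fin 4) (PadicAlgCl p)) : Matrix (Fin 4) (Fin 4) (PadicAlgCl p)) =
      Matrix.reindex ε ε ((Q⁻¹ : GL (Fin 2 ⊕ Fin 2) (PadicAlgCl p)) :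
        Matrix (Fin 2 ⊕ Fin 2) (Fin 2 ⊕ Fin 2) (PadicAlgCl p)) := by
    rw [← map_inv]
    rfl
  -- the residual conjugator `h ∈ GL₄(k)`: a permutation matrix times a block-diagonal matrix
  obtain ⟨Pm, hPm⟩ := exists_units_submatrix_eq_conj (R := k) (ε.symm.trans finSumFinEquiv)
  let Hd : GL (Fin 2 ⊕ Fin 2) k :=
    ⟨Matrix.fromBlocks ((h₁⁻¹ : GL (Fin 2) k) : Matrix (Fin 2) (Fin 2) k) 0 0
      ((h₂⁻¹ : GL (Fin 2) k) : Matrix (Fin 2) (Fin 2) k),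
     Matrix.fromBlocks (h₁ : Matrix (Fin 2) (Fin 2) k) 0 0 (h₂ : Matrix (Fin 2) (Fin 2) k),
     by rw [Matrix.fromBlocks_multiply]; simp [Matrix.fromBlocks_one],
     by rw [Matrix.fromBlocks_multiply]; simp [Matrix.fromBlocks_one]⟩
  let Hd₄ : GL (Fin 4) k := Units.map (Matrix.reindexRingEquiv k finSumFinEquiv).toMonoidHom Hd
  have hHd₄ : (Hd₄ : Matrix (Fin 4) (Fin 4) k) = Matrix.reindex finSumFinEquiv finSumFinEquiv
      (Matrix.fromBlocks ((h₁⁻¹ : GL (Fin 2) k) : Matrix (Fin 2) (Fin 2) k) 0 0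
        ((h₂⁻¹ : GL (Fin 2) k) : Matrix (Fin 2) (Fin 2) k)) := rfl
  have hHd₄inv : ((Hd₄⁻¹ : GL (Fin 4) k) : Matrix (Fin 4) (Fin 4) k) = Matrix.reindex finSumFinEquiv finSumFinEquiv
      (Matrix.fromBlocks (h₁ : Matrix (Fin 2) (Fin 2) k) 0 0 (h₂ : Matrix (Fin 2) (Fin 2) k)) := by
    rw [← map_inv]
    rfl
  -- the corner in the `(σ, σ')`-frame
  let B : Field.absoluteGaloisGroup ℚ → Matrix (Fin 2) (Fin 2) k := fun g =>
    (h₁ : Matrix (Fin 2) (Fin 2) k) * (b g).map f * ((h₂⁻¹ : GL (Fin 2) k) : Matrix (Fin 2) (Fin 2) k)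
  refine ⟨P * Q₄, rint', Pm * Hd₄, B, fun g => ?_, fun g => ?_, ?_⟩
  · -- the frame
    apply Units.ext
    have h3 : ((Matrix.GeneralLinearGroup.map (Valued.integer (PadicAlgCl p)).subtype (ρε g) :
        GL (Fin 2 ⊕ Fin 2) (PadicAlgCl p)) : Matrix (Fin 2 ⊕ Fin 2) (Fin 2 ⊕ Fin 2) (PadicAlgCl p)) =
          ((P⁻¹ * r g * P : GL (Fin 4) (PadicAlgCl p)) : Matrix (Fin 4) (Fin 4) (PadicAlgCl p)).submatrix ε ε := by
      ext i j
      change ((((ρε g : GL (Fin 2 ⊕ Fin 2) (Valued.integer (PadicAlgCl p))) :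
        Matrix (Fin 2 ⊕ Fin 2) (Fin 2 ⊕ Fin 2) (Valued.integer (PadicAlgCl p))) i j :
          Valued.integer (PadicAlgCl p)) : PadicAlgCl p) = _
      rw [hρε, Matrix.submatrix_apply, hcoe, Matrix.submatrix_apply]
    have h4 := congrArg (fun M : GL (Fin 2 ⊕ Fin 2) (PadicAlgCl p) =>
      (M : Matrix (Fin 2 ⊕ Fin 2) (Fin 2 ⊕ Fin 2) (PadicAlgCl p))) (hρ' g)
    simp only [Units.val_mul] at h4
    rw [h3] at h4
    change Matrix.reindex ε ε ((((ρ' g : GL (Fin 2 ⊕ Fin 2) (Valued.integer (PadicAlgCl p))) :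
      Matrix (Fin 2 ⊕ Fin 2) (Fin 2 ⊕ Fin 2) (Valued.integer (PadicAlgCl p)))).map
        (Valued.integer (PadicAlgCl p)).subtype) = _
    have h5 : ((((ρ' g : GL (Fin 2 ⊕ Fin 2) (Valued.integer (PadicAlgCl p))) :
      Matrix (Fin 2 ⊕ Fin 2) (Fin 2 ⊕ Fin 2) (Valued.integer (PadicAlgCl p)))).map
        (Valued.integer (PadicAlgCl p)).subtype) =
        ((Matrix.GeneralLinearGroup.map (Valued.integer (PadicAlgCl p)).subtype (ρ' g) :
          GL (Fin 2 ⊕ Fin 2) (PadicAlgCl p)) : Matrix (Fin 2 ⊕ Fin 2) (Fin 2 ⊕ Fin 2) (PadicAlgCl p)) := rfl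
    rw [h5, h4, reindex_conj_submatrix, ← hQ₄, ← hQ₄inv]
    simp only [Units.val_mul, _root_.mul_inv_rev, Matrix.mul_assoc]
  · -- the residual form
    have h2 : ((((ρ' g : GL (Fin 2 ⊕ Fin 2) (Valued.integer (PadicAlgCl p))) :
        Matrix (Fin 2 ⊕ Fin 2) (Fin 2 ⊕ Fin 2) (Valued.integer (PadicAlgCl p)))).map red) =
        Matrix.fromBlocks ((h₁⁻¹ : GL (Fin 2) k) : Matrix (Fin 2) (Fin 2) k) 0 0
            ((h₂⁻¹ : GL (Fin 2) k) : Matrix (Fin 2) (Fin 2) k) *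
          Matrix.fromBlocks (σ g).val (B g) 0 (σ' g).val *
          Matrix.fromBlocks (h₁ : Matrix (Fin 2) (Fin 2) k) 0 0 (h₂ : Matrix (Fin 2) (Fin 2) k) := by
      rw [← hfres, RingHom.coe_comp, ← Matrix.map_map, hres' g, h11, h22, Matrix.fromBlocks_map,
        Matrix.map_zero _ (map_zero f),
        ← fromBlocks_conj_blockDiag h₁ h₂ (σ g).val (σ' g).val ((b g).map f)]
      change Matrix.fromBlocks (((a₁ g).val).map f) _ 0 (((d₁ g).val).map f) = _
      rw [hfa, hfd]
    change (Matrix.reindex ε ε ((ρ' g : GL (Fin 2 ⊕ Fin 2) (Valued.integer (PadicAlgCl p))) :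
      Matrix (Fin 2 ⊕ Fin 2) (Fin 2 ⊕ Fin 2) (Valued.integer (PadicAlgCl p)))).map red = _
    have hmapr : (Matrix.reindex ε ε ((ρ' g : GL (Fin 2 ⊕ Fin 2) (Valued.integer (PadicAlgCl p))) :
        Matrix (Fin 2 ⊕ Fin 2) (Fin 2 ⊕ Fin 2) (Valued.integer (PadicAlgCl p)))).map red =
        Matrix.reindex ε ε ((((ρ' g : GL (Fin 2 ⊕ Fin 2) (Valued.integer (PadicAlgCl p))) :
          Matrix (Fin 2 ⊕ Fin 2) (Fin 2 ⊕ Fin 2) (Valued.integer (PadicAlgCl p)))).map red) := rfl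
    rw [hmapr, h2, Units.val_mul, _root_.mul_inv_rev, Units.val_mul, hHd₄, hHd₄inv]
    -- `reindex ε ε Y = Pm * reindex e e Y * Pm⁻¹`, and `reindex e e` is multiplicative
    have hεe : ∀ Y : Matrix (Fin 2 ⊕ Fin 2) (Fin 2 ⊕ Fin 2) k,
        Matrix.reindex ε ε Y = (Pm : Matrix (Fin 4) (Fin 4) k) * Matrix.reindex finSumFinEquiv finSumFinEquiv Y *
          (Pm⁻¹ : GL (Fin 4) k) := by
      intro Y
      rw [← hPm, Matrix.reindex_apply, Matrix.reindex_apply, Matrix.submatrix_submatrix]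
      congr 1 <;> ext x <;> simp
    have hmul : ∀ X Y : Matrix (Fin 2 ⊕ Fin 2) (Fin 2 ⊕ Fin 2) k,
        Matrix.reindex finSumFinEquiv finSumFinEquiv (X * Y) =
          Matrix.reindex finSumFinEquiv finSumFinEquiv X * Matrix.reindex finSumFinEquiv finSumFinEquiv Y :=
      fun X Y => (Matrix.reindexRingEquiv k finSumFinEquiv).map_mul X Y
    rw [hεe, hmul, hmul]
    simp only [Matrix.mul_assoc]
  · -- non-split over `κ` stays non-split over `k`
    rintro ⟨X, hX⟩
    apply hncb
    have hfb : ∀ g, (b g).map f = ((a₁ g).val).map f * (((h₁⁻¹ : GL (Fin 2) k) : Matrix (Fin 2) (Fin 2) k) * X *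
        (h₂ : Matrix (Fin 2) (Fin 2) k)) - (((h₁⁻¹ : GL (Fin 2) k) : Matrix (Fin 2) (Fin 2) k) * X *
        (h₂ : Matrix (Fin 2) (Fin 2) k)) * ((d₁ g).val).map f := by
      intro g
      rw [hfa, hfd]
      exact coboundary_conj_transport h₁ h₂ (σ g).val (σ' g).val ((b g).map f) X (hX g)
    -- descent to the subfield `f(κ)`
    obtain ⟨X₁, hX₁k, hX₁⟩ := coboundary_descent f.fieldRange (fun g => ((a₁ g).val).map f)
      (fun g => ((d₁ g).val).map f) (fun g => (b g).map f) (fun g i j => ⟨_, rfl⟩) (fun g i j => ⟨_, rfl⟩)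
      (fun g i j => ⟨_, rfl⟩) hfb
    have hlift : ∀ i j, ∃ y, f y = X₁ i j := fun i j => hX₁k i j
    choose y hy using hlift
    refine ⟨Matrix.of y, fun g => ?_⟩
    have hinj : Function.Injective
        (fun M : Matrix (Fin 2) (Fin 2) (ResidueField (Valued.integer (PadicAlgCl p))) => M.map f) :=
      fun M N hMN => Matrix.ext fun i j => f.injective (congrFun (congrFun hMN i) j)
    apply hinj
    have hY : (Matrix.of y).map f = X₁ := Matrix.ext fun i j => hy i j
    dsimp only
    rw [Matrix.map_sub _ (map_sub f), Matrix.map_mul, Matrix.map_mul, h11, h22, hY]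
    exact hX₁ g

/-- **Ribet's non-split lattice, the other direction**: under the same hypotheses some integral frame of `r`
reduces (up to `GL₄(k)`-conjugacy) to `(σ', B'; 0, σ)` with `B'` not a coboundary `σ' X - X σ` — a non-zero class
in `H¹(ℚ, Hom(σ̄, σ̄'))`.  (Apply `stub_ribetNonsplitLattice` with the roles of `σ, σ'` exchanged.)
[cite: Ribet1976, Prop. 2.1; BellaicheChenevier2009, Thm. 1.5.5] -/
theorem ribetNonsplitLattice_symm {k : Type} [Field k] [CharP k p] [IsAlgClosed k] [TopologicalSpace k]
    [DiscreteTopology k] (red : Valued.integer (PadicAlgCl p) →+* k) (σ σ' : FramedGaloisRep ℚ k 2)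
    (r : FramedGaloisRep ℚ (PadicAlgCl p) 4) (hσ : σ.toGaloisRep.IsIrreducible)
    (hσ' : σ'.toGaloisRep.IsIrreducible) (hnc : ¬ ∃ g : GL (Fin 2) k, ∀ x, g * σ x * g⁻¹ = σ' x)
    (hr : r.toGaloisRep.IsIrreducible)
    (hae : ∀ᶠ v : HeightOneSpectrum (NumberField.RingOfIntegers ℚ) in Filter.cofinite,
      r.IsUnramifiedAt v ∧ σ.IsUnramifiedAt v ∧ σ'.IsUnramifiedAt v ∧
      ∃ (P : Polynomial (Valued.integer (PadicAlgCl p))) (P₁ P₂ : Polynomial k),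
        r.HasFrobCharpolyAt v (P.map (Valued.integer (PadicAlgCl p)).subtype) ∧
        σ.HasFrobCharpolyAt v P₁ ∧ σ'.HasFrobCharpolyAt v P₂ ∧ P.map red = P₁ * P₂) :
    ∃ (P : GL (Fin 4) (PadicAlgCl p))
      (rint : Field.absoluteGaloisGroup ℚ →* GL (Fin 4) (Valued.integer (PadicAlgCl p)))
      (h : GL (Fin 4) k) (B' : Field.absoluteGaloisGroup ℚ → Matrix (Fin 2) (Fin 2) k),
      (∀ g, Matrix.GeneralLinearGroup.map (Valued.integer (PadicAlgCl p)).subtype (rint g) = P⁻¹ * r g * P) ∧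
      (∀ g, (Matrix.GeneralLinearGroup.map red (rint g)).val =
        h.val * Matrix.reindex finSumFinEquiv finSumFinEquiv
          (Matrix.fromBlocks (σ' g).val (B' g) 0 (σ g).val) * (h⁻¹).val) ∧
      ¬ ∃ X : Matrix (Fin 2) (Fin 2) k, ∀ g, B' g = (σ' g).val * X - X * (σ g).val := by
  have hnc' : ¬ ∃ g : GL (Fin 2) k, ∀ x, g * σ' x * g⁻¹ = σ x := by
    rintro ⟨g, hg⟩
    exact hnc ⟨g⁻¹, fun x => by rw [← hg x]; group⟩
  have hae' : ∀ᶠ v : HeightOneSpectrum (NumberField.RingOfIntegers ℚ) in Filter.cofinite,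
      r.IsUnramifiedAt v ∧ σ'.IsUnramifiedAt v ∧ σ.IsUnramifiedAt v ∧
      ∃ (P : Polynomial (Valued.integer (PadicAlgCl p))) (P₁ P₂ : Polynomial k),
        r.HasFrobCharpolyAt v (P.map (Valued.integer (PadicAlgCl p)).subtype) ∧
        σ'.HasFrobCharpolyAt v P₁ ∧ σ.HasFrobCharpolyAt v P₂ ∧ P.map red = P₁ * P₂ := by
    filter_upwards [hae] with v hv
    obtain ⟨hr', hσv, hσ'v, P, P₁, P₂, hP, hP₁, hP₂, hred⟩ := hv
    exact ⟨hr', hσ'v, hσv, P, P₂, P₁, hP, hP₂, hP₁, by rw [hred, mul_comm]⟩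
  exact stub_ribetNonsplitLattice p k red σ' σ r hσ' hσ hnc' hr hae'

end Assembly

end Summit.Langlands.Langlands.Cruxes.ResiduallyYoshidaLifting.SectorKlingenSplit.Ribet

end
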